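import Literature.NumberTheory.Automorphic.GodementJacquetThetaGrowth
import Literature.NumberTheory.Automorphic.GodementJacquetCenterMellin
import Literature.NumberTheory.Automorphic.IdeleNormDetGL
import Literature.NumberTheory.Automorphic.AdelicHeightGLSiegel
import HarnessLib

/-!
# Majorants for the singular terms of the Godement–Jacquet reflection formula

Topic `NumberTheory/Automorphic`; namespace `Literature.NumberTheory.Automorphic`. Proof file
(theorems only). For `Φ ∈ 𝒮(M_n(𝔸_K))`, a fixed `x₀ ∈ GL_n(𝔸_K)` and the Haar measure `α` of the
split centre `A_G ≅ ℝ_{>0}` (`α ↦ c · Lebesgue` under `centerLog`), the **central integrals of the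
full theta majorant against the truncation weights are of polynomial growth in the height of `y`**,
uniformly for finite parts `y_f` in a compact set:

* `exists_lintegral_center_truncTheta_le` (`Re s > n + 1`):
  `∫_{A_G} |F₁^<(x₀ a y⁻¹)| Σ_{ξ ∈ M_n(K)} |Φ(x₀ ξ a y⁻¹)| dα(a) ≤ C (1 ⊔ ‖y‖)^{2θ}`,
  `θ = n²[K:ℚ] + 1`;
* `exists_lintegral_center_dualTheta_le` (`Re s > 2n + 1`): the same for
  `|F''_{n-s}(y a x₀⁻¹)| Σ_ξ |Ψ(y a ξ x₀⁻¹)|`.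

Ingredients: the theta growth bound `Σ_ξ |Φ(A ξ B)| ≤ B (1 ⊔ n⁴ H_∞(A) H_∞(B))^θ`
(`GodementJacquetThetaGrowth`), the height of central elements (`adelicHeightGL_centerLog_symm_le`:
`‖a(v)‖ ≤ e^{|v|/(n d)}`-type bounds), `|det|` versus height (`adelicAbsDet_le_height`,
`adelicAbsDet_inv_le_height`), and the one-variable integrals
`∫_{v ≤ -log R} R^σ e^{σ v} e^{κ|v|} dv ≤ …` (`lintegral_indicator_truncWeight_le`,
`lintegral_indicator_dualWeight_le`). These are the estimates which make the singular theta terms of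
Godement–Jacquet (1972), §12 absolutely integrable against cusp forms for one fixed variable.

## References

* R. Godement, H. Jacquet, *Zeta functions of simple algebras*, LNM 260 (1972), §11–12
  [GodementJacquetLNM260].
-/

noncomputable section

open scoped NNReal ENNReal
open NumberField IsDedekindDomain Set MeasureTheory Measure Matrix Module Filter

namespace Literature.NumberTheory.Automorphic

/-! ### Real-variable lemmas: the integrals `∫_{v < -log R} R^σ e^{σ v} e^{± κ v} dv` -/

section Real

/-- `e^{κ |v|} ≤ e^{κ v} + e^{-κ v}`. [folklore] -/
theorem exp_mul_abs_le_add (κ v : ℝ) :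
    Real.exp (κ * |v|) ≤ Real.exp (κ * v) + Real.exp (-(κ * v)) := by
  rcases le_total 0 v with hv | hv
  · rw [abs_of_nonneg hv]
    exact le_add_of_nonneg_right (Real.exp_pos _).le
  · rw [abs_of_nonpos hv, mul_neg]
    exact le_add_of_nonneg_left (Real.exp_pos _).le

/-- **`∫_{v ≤ -log R} R^σ e^{ℓ v} dv = R^{σ - ℓ}/ℓ`** for `ℓ > 0`, `R > 0` (as a Lebesgue integral of
a non-negative function). [folklore] -/
theorem lintegral_Iic_rpow_mul_exp_mul {R σ ℓ : ℝ} (hR : 0 < R) (hℓ : 0 < ℓ) :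
    ∫⁻ v in Iic (-Real.log R), ENNReal.ofReal (R ^ σ * Real.exp (ℓ * v)) =
      ENNReal.ofReal (R ^ (σ - ℓ) / ℓ) := by
  have hint : IntegrableOn (fun v => R ^ σ * Real.exp (ℓ * v)) (Iic (-Real.log R)) :=
    (integrableOn_exp_mul_Iic hℓ _).const_mul _
  rw [← ofReal_integral_eq_lintegral_ofReal hint
    (ae_of_all _ fun v => mul_nonneg (Real.rpow_nonneg hR.le _) (Real.exp_pos _).le)]
  congr 1
  rw [integral_const_mul, integral_exp_mul_Iic hℓ, show ℓ * -Real.log R = Real.log R * (-ℓ) by ring,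
    ← Real.rpow_def_of_pos hR (-ℓ), sub_eq_add_neg, Real.rpow_add hR]
  field_simp

/-- **The `v`-integral of the `Φ`-side majorant**: for `0 ≤ κ < σ` and `R > 0`,
`∫_{v < -log R} R^σ e^{σ v} (e^{κ v} + e^{-κ v}) dv ≤ (R^{-κ} + R^{κ}) / (σ - κ)`. [folklore] -/
theorem lintegral_indicator_truncWeight_le {R σ κ : ℝ} (hR : 0 < R) (hκ : 0 ≤ κ) (hκσ : κ < σ) :
    ∫⁻ v, (Iio (-Real.log R)).indicator
        (fun v => ENNReal.ofReal (R ^ σ * Real.exp (σ * v) * (Real.exp (κ * v) + Real.exp (-(κ * v))))) v ≤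
      ENNReal.ofReal ((R ^ (-κ) + R ^ κ) / (σ - κ)) := by
  have h1 : 0 < σ + κ := by linarith
  have h2 : 0 < σ - κ := by linarith
  calc ∫⁻ v, (Iio (-Real.log R)).indicator
        (fun v => ENNReal.ofReal (R ^ σ * Real.exp (σ * v) * (Real.exp (κ * v) + Real.exp (-(κ * v))))) v
      ≤ ∫⁻ v, (Iic (-Real.log R)).indicator
        (fun v => ENNReal.ofReal (R ^ σ * Real.exp (σ * v) * (Real.exp (κ * v) + Real.exp (-(κ * v))))) v :=
        lintegral_mono fun v => indicator_le_indicator_of_subset Iio_subset_Iic_self (fun _ => zero_le) v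
    _ = ∫⁻ v in Iic (-Real.log R), (ENNReal.ofReal (R ^ σ * Real.exp ((σ + κ) * v)) +
          ENNReal.ofReal (R ^ σ * Real.exp ((σ - κ) * v))) := by
        rw [← lintegral_indicator measurableSet_Iic]
        refine lintegral_congr fun v => ?_
        refine congrArg₂ (fun (s : Set ℝ) (f : ℝ → ℝ≥0∞) => s.indicator f v) rfl (funext fun v => ?_)
        rw [← ENNReal.ofReal_add (mul_nonneg (Real.rpow_nonneg hR.le _) (Real.exp_pos _).le)
          (mul_nonneg (Real.rpow_nonneg hR.le _) (Real.exp_pos _).le)]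
        congr 1
        rw [show (σ + κ) * v = σ * v + κ * v by ring, show (σ - κ) * v = σ * v + -(κ * v) by ring,
          Real.exp_add, Real.exp_add]
        ring
    _ = ENNReal.ofReal (R ^ (σ - (σ + κ)) / (σ + κ)) + ENNReal.ofReal (R ^ (σ - (σ - κ)) / (σ - κ)) := by
        rw [lintegral_add_left (by fun_prop), lintegral_Iic_rpow_mul_exp_mul hR h1,
          lintegral_Iic_rpow_mul_exp_mul hR h2]
    _ ≤ ENNReal.ofReal ((R ^ (-κ) + R ^ κ) / (σ - κ)) := by
        rw [show σ - (σ + κ) = -κ by ring, show σ - (σ - κ) = κ by ring,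
          ← ENNReal.ofReal_add (div_nonneg (Real.rpow_nonneg hR.le _) h1.le)
            (div_nonneg (Real.rpow_nonneg hR.le _) h2.le), add_div]
        refine ENNReal.ofReal_le_ofReal (add_le_add ?_ le_rfl)
        exact div_le_div_of_nonneg_left (Real.rpow_nonneg hR.le _) h2 (by linarith)

/-- **`∫_{v > -log R} R^{-τ} e^{-ℓ v} dv = R^{ℓ - τ}/ℓ`** for `ℓ > 0`, `R > 0`. [folklore] -/
theorem lintegral_Ioi_rpow_mul_exp_neg_mul {R τ ℓ : ℝ} (hR : 0 < R) (hℓ : 0 < ℓ) :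
    ∫⁻ v in Ioi (-Real.log R), ENNReal.ofReal (R ^ (-τ) * Real.exp (-ℓ * v)) =
      ENNReal.ofReal (R ^ (ℓ - τ) / ℓ) := by
  have hℓ' : -ℓ < 0 := by linarith
  have hint : IntegrableOn (fun v => R ^ (-τ) * Real.exp (-ℓ * v)) (Ioi (-Real.log R)) :=
    (integrableOn_exp_mul_Ioi hℓ' _).const_mul _
  rw [← ofReal_integral_eq_lintegral_ofReal hint
    (ae_of_all _ fun v => mul_nonneg (Real.rpow_nonneg hR.le _) (Real.exp_pos _).le)]
  congr 1
  rw [integral_const_mul, integral_exp_mul_Ioi hℓ', show -ℓ * -Real.log R = Real.log R * ℓ by ring,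
    ← Real.rpow_def_of_pos hR ℓ, sub_eq_add_neg, Real.rpow_add hR]
  field_simp

/-- **The `v`-integral of the `Φ̂`-side majorant**: for `0 ≤ κ < τ` and `R > 0`,
`∫_{v > -log R} R^{-τ} e^{-τ v} (e^{κ v} + e^{-κ v}) dv ≤ (R^{-κ} + R^{κ}) / (τ - κ)`. [folklore] -/
theorem lintegral_indicator_dualWeight_le {R τ κ : ℝ} (hR : 0 < R) (hκ : 0 ≤ κ) (hκτ : κ < τ) :
    ∫⁻ v, (Ioi (-Real.log R)).indicator
        (fun v => ENNReal.ofReal (R ^ (-τ) * Real.exp (-(τ * v)) * (Real.exp (κ * v) + Real.exp (-(κ * v))))) v ≤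
      ENNReal.ofReal ((R ^ (-κ) + R ^ κ) / (τ - κ)) := by
  have h1 : 0 < τ + κ := by linarith
  have h2 : 0 < τ - κ := by linarith
  calc ∫⁻ v, (Ioi (-Real.log R)).indicator
        (fun v => ENNReal.ofReal (R ^ (-τ) * Real.exp (-(τ * v)) * (Real.exp (κ * v) + Real.exp (-(κ * v))))) v
      = ∫⁻ v in Ioi (-Real.log R), (ENNReal.ofReal (R ^ (-τ) * Real.exp (-(τ - κ) * v)) +
          ENNReal.ofReal (R ^ (-τ) * Real.exp (-(τ + κ) * v))) := by
        rw [← lintegral_indicator measurableSet_Ioi]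
        refine lintegral_congr fun v => ?_
        refine congrArg₂ (fun (s : Set ℝ) (f : ℝ → ℝ≥0∞) => s.indicator f v) rfl (funext fun v => ?_)
        rw [← ENNReal.ofReal_add (mul_nonneg (Real.rpow_nonneg hR.le _) (Real.exp_pos _).le)
          (mul_nonneg (Real.rpow_nonneg hR.le _) (Real.exp_pos _).le)]
        congr 1
        rw [show -(τ - κ) * v = -(τ * v) + κ * v by ring, show -(τ + κ) * v = -(τ * v) + -(κ * v) by ring,
          Real.exp_add, Real.exp_add]
        ring
    _ = ENNReal.ofReal (R ^ ((τ - κ) - τ) / (τ - κ)) + ENNReal.ofReal (R ^ ((τ + κ) - τ) / (τ + κ)) := by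
        rw [lintegral_add_left (by fun_prop), lintegral_Ioi_rpow_mul_exp_neg_mul hR h2,
          lintegral_Ioi_rpow_mul_exp_neg_mul hR h1]
    _ ≤ ENNReal.ofReal ((R ^ (-κ) + R ^ κ) / (τ - κ)) := by
        rw [show (τ - κ) - τ = -κ by ring, show (τ + κ) - τ = κ by ring,
          ← ENNReal.ofReal_add (div_nonneg (Real.rpow_nonneg hR.le _) h2.le)
            (div_nonneg (Real.rpow_nonneg hR.le _) h1.le), add_div]
        refine ENNReal.ofReal_le_ofReal (add_le_add le_rfl ?_)
        exact div_le_div_of_nonneg_left (Real.rpow_nonneg hR.le _) h2 (by linarith)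

end Real

/-! ### Heights along the centre, and the theta factor along the centre -/

section Centre

variable {n : ℕ} {K : Type} [Field K] [NumberField K]

/-- `H_∞(g) ≤ ‖g‖` (the finite local heights are `≥ 1`; `n ≥ 1`). [folklore] -/
theorem archHeight_le_adelicHeightGL [NeZero n] (g : GL (Fin n) (AdeleRing (𝓞 K) K)) :
    (GLn.archHeight n K g : ℝ) ≤ adelicHeightGL n K g :=
  le_mul_of_one_le_right (NNReal.coe_nonneg _) (GLn.one_le_finprod_localHeight g)

/-- **The height along the centre**: `‖a‖ ≤ e^{|v|/(n[K:ℚ])}` for `a ∈ A_G` with `v = log |det a|_𝔸`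
(`a = z(e^{v/(n[K:ℚ])})`, `‖z(ρ)‖ ≤ ρ ⊔ ρ⁻¹`). [folklore] -/
theorem adelicHeightGL_centerLog_symm_le (hn : 0 < n) (v : ℝ) :
    adelicHeightGL n K (((centerLog n K hn).symm v : (AdelicGroupData.gl n K).center') :
        (AdelicGroupData.gl n K).Adelic) ≤
      Real.exp (|v| / ((n * Module.finrank ℚ K : ℕ) : ℝ)) := by
  set N : ℝ := ((n * Module.finrank ℚ K : ℕ) : ℝ) with hN
  change adelicHeightGL n K (posRealScalar n K (expUnitNNReal (v / N))) ≤ Real.exp (|v| / N)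
  refine (adelicHeightGL_posRealScalar_le _).trans (max_le ?_ ?_)
  · rw [coe_expUnitNNReal]
    exact Real.exp_le_exp.2 (div_le_div_of_nonneg_right (le_abs_self v) (by positivity))
  · rw [coe_expUnitNNReal, ← Real.exp_neg, ← neg_div]
    exact Real.exp_le_exp.2 (div_le_div_of_nonneg_right (neg_le_abs v) (by positivity))

/-- The height of `a ∈ A_G` in terms of `v = centerLog a`. [folklore] -/
theorem adelicHeightGL_center_le (hn : 0 < n) (a : (AdelicGroupData.gl n K).center') :
    adelicHeightGL n K ((a : (AdelicGroupData.gl n K).Adelic) : GL (Fin n) (AdeleRing (𝓞 K) K)) ≤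
      Real.exp (|centerLog n K hn a| / ((n * Module.finrank ℚ K : ℕ) : ℝ)) := by
  have h := adelicHeightGL_centerLog_symm_le (K := K) hn (centerLog n K hn a)
  rwa [Homeomorph.symm_apply_apply] at h

/-- **The archimedean height of `a y⁻¹`**, `a ∈ A_G`: `H_∞(a y⁻¹) ≤ n e^{|v|/(n[K:ℚ])} ‖y‖`. [folklore] -/
theorem archHeight_center_mul_inv_le (hn : 0 < n) (a : (AdelicGroupData.gl n K).center')
    (y : (AdelicGroupData.gl n K).Adelic) :
    (GLn.archHeight n K (((a : (AdelicGroupData.gl n K).Adelic) * y⁻¹ : (AdelicGroupData.gl n K).Adelic) :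
        GL (Fin n) (AdeleRing (𝓞 K) K)) : ℝ) ≤
      n * Real.exp (|centerLog n K hn a| / ((n * Module.finrank ℚ K : ℕ) : ℝ)) *
        adelicHeightGL n K (y : GL (Fin n) (AdeleRing (𝓞 K) K)) := by
  haveI : NeZero n := ⟨hn.ne'⟩
  set g : GL (Fin n) (AdeleRing (𝓞 K) K) := (a : (AdelicGroupData.gl n K).Adelic) with hg
  set h : GL (Fin n) (AdeleRing (𝓞 K) K) := y with hh
  have hprod : (((a : (AdelicGroupData.gl n K).Adelic) * y⁻¹ : (AdelicGroupData.gl n K).Adelic) :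
      GL (Fin n) (AdeleRing (𝓞 K) K)) = g * h⁻¹ := rfl
  rw [hprod]
  calc (GLn.archHeight n K (g * h⁻¹) : ℝ) ≤ adelicHeightGL n K (g * h⁻¹) := archHeight_le_adelicHeightGL _
    _ ≤ n * adelicHeightGL n K g * adelicHeightGL n K h⁻¹ := adelicHeightGL_mul_le_const g h⁻¹
    _ = n * adelicHeightGL n K g * adelicHeightGL n K h := by rw [adelicHeightGL_inv]
    _ ≤ n * Real.exp (|centerLog n K hn a| / ((n * Module.finrank ℚ K : ℕ) : ℝ)) * adelicHeightGL n K h := by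
        gcongr
        · exact adelicHeightGL_nonneg h
        · exact adelicHeightGL_center_le hn a

/-- **The theta factor along the centre (the `Φ`-side).** If
`Σ_ξ |Φ(A ξ B)| ≤ B₀ (1 ⊔ N² H_∞(A) H_∞(B))^θ` (`θ ≥ 0`) then for `A = x₀`, `B = a y⁻¹` (`a ∈ A_G`,
`v = centerLog a`):
`Σ_ξ |Φ(x₀ ξ a y⁻¹)| ≤ B₀ ((1 ⊔ N² n H_∞(x₀)) (1 ⊔ ‖y‖))^θ · e^{θ |v| /(n[K:ℚ])}`. [folklore] -/
theorem thetaBound_center_mul_inv {θ : ℝ} (hθ : 0 ≤ θ) (hn : 0 < n) {N2 : ℝ} (hN2 : 0 ≤ N2)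
    {B₀ T : ℝ≥0∞} (x₀ y : (AdelicGroupData.gl n K).Adelic) (a : (AdelicGroupData.gl n K).center')
    (hT : T ≤ B₀ * ENNReal.ofReal ((max 1 (N2 *
      ((GLn.archHeight n K (x₀ : GL (Fin n) (AdeleRing (𝓞 K) K)) : ℝ) *
        (GLn.archHeight n K (((a : (AdelicGroupData.gl n K).Adelic) * y⁻¹ : (AdelicGroupData.gl n K).Adelic) :
          GL (Fin n) (AdeleRing (𝓞 K) K)) : ℝ)))) ^ θ)) :
    T ≤ B₀ * ENNReal.ofReal (((max 1 (N2 * n * (GLn.archHeight n K (x₀ : GL (Fin n) (AdeleRing (𝓞 K) K)) : ℝ))) *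
        (max 1 (adelicHeightGL n K (y : GL (Fin n) (AdeleRing (𝓞 K) K))))) ^ θ) *
      ENNReal.ofReal (Real.exp (θ * |centerLog n K hn a| / ((n * Module.finrank ℚ K : ℕ) : ℝ))) := by
  set Ninf : ℝ := ((n * Module.finrank ℚ K : ℕ) : ℝ) with hNinf
  set E : ℝ := Real.exp (|centerLog n K hn a| / Ninf) with hE
  set Hx : ℝ := (GLn.archHeight n K (x₀ : GL (Fin n) (AdeleRing (𝓞 K) K)) : ℝ) with hHx
  set Hy : ℝ := adelicHeightGL n K (y : GL (Fin n) (AdeleRing (𝓞 K) K)) with hHy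
  have hE1 : 1 ≤ E := Real.one_le_exp (div_nonneg (abs_nonneg _) (by positivity))
  have hHx0 : 0 ≤ Hx := NNReal.coe_nonneg _
  have hHy0 : 0 ≤ Hy := adelicHeightGL_nonneg _
  refine hT.trans ?_
  rw [mul_assoc, ← ENNReal.ofReal_mul (Real.rpow_nonneg (by positivity) _)]
  refine mul_le_mul_right (ENNReal.ofReal_le_ofReal ?_) _
  have hkey : max 1 (N2 * (Hx * (GLn.archHeight n K
      (((a : (AdelicGroupData.gl n K).Adelic) * y⁻¹ : (AdelicGroupData.gl n K).Adelic) :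
        GL (Fin n) (AdeleRing (𝓞 K) K)) : ℝ))) ≤ (max 1 (N2 * n * Hx)) * (max 1 Hy) * E := by
    refine max_le ?_ ?_
    · calc (1 : ℝ) = 1 * 1 * 1 := by ring
        _ ≤ (max 1 (N2 * n * Hx)) * (max 1 Hy) * E :=
            mul_le_mul (mul_le_mul (le_max_left _ _) (le_max_left _ _) zero_le_one (zero_le_one.trans (le_max_left _ _)))
              hE1 zero_le_one (mul_nonneg (zero_le_one.trans (le_max_left _ _)) (zero_le_one.trans (le_max_left _ _)))
    · calc N2 * (Hx * (GLn.archHeight n K (((a : (AdelicGroupData.gl n K).Adelic) * y⁻¹ :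
            (AdelicGroupData.gl n K).Adelic) : GL (Fin n) (AdeleRing (𝓞 K) K)) : ℝ))
          ≤ N2 * (Hx * (n * E * Hy)) := by
            gcongr
            exact archHeight_center_mul_inv_le hn a y
        _ = (N2 * n * Hx) * Hy * E := by ring
        _ ≤ (max 1 (N2 * n * Hx)) * (max 1 Hy) * E := by
            gcongr
            · exact le_max_right _ _
            · exact le_max_right _ _
  calc (max 1 (N2 * (Hx * (GLn.archHeight n K (((a : (AdelicGroupData.gl n K).Adelic) * y⁻¹ :
        (AdelicGroupData.gl n K).Adelic) : GL (Fin n) (AdeleRing (𝓞 K) K)) : ℝ)))) ^ θ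
      ≤ ((max 1 (N2 * n * Hx)) * (max 1 Hy) * E) ^ θ :=
        Real.rpow_le_rpow (zero_le_one.trans (le_max_left _ _)) hkey hθ
    _ = ((max 1 (N2 * n * Hx)) * (max 1 Hy)) ^ θ * E ^ θ :=
        Real.mul_rpow (mul_nonneg (zero_le_one.trans (le_max_left _ _)) (zero_le_one.trans (le_max_left _ _)))
          (zero_le_one.trans hE1)
    _ = ((max 1 (N2 * n * Hx)) * (max 1 Hy)) ^ θ * Real.exp (θ * |centerLog n K hn a| / Ninf) := by
        rw [hE, ← Real.exp_mul, div_mul_eq_mul_div, mul_comm _ θ]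

end Centre

/-! ### The weights along the centre and the `Φ`-side majorant -/

section TruncSide

variable {n : ℕ} {K : Type} [Field K] [NumberField K]

attribute [local instance] adelicBorel borelSpace_adelic locallyCompactSpace_adelic
  secondCountableTopology_gl_adelic

/-- `a ∈ A_G` has trivial finite component (local copy of `GLn.sndHom_posRealScalar`). [folklore] -/
theorem sndHom_center_eq_one (a : (AdelicGroupData.gl n K).center') :
    GLn.sndHom n K ((a : (AdelicGroupData.gl n K).Adelic) : GL (Fin n) (AdeleRing (𝓞 K) K)) = 1 := by
  obtain ⟨_, ρ, rfl⟩ := a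
  refine Matrix.GeneralLinearGroup.ext fun i j => ?_
  change ((Matrix.scalar (Fin n) ((posRealIdele K ρ : (AdeleRing (𝓞 K) K)ˣ) : AdeleRing (𝓞 K) K) i j).2) =
    (1 : Matrix (Fin n) (Fin n) (FiniteAdeleRing (𝓞 K) K)) i j
  rw [Matrix.scalar_apply, Matrix.diagonal_apply, Matrix.one_apply]
  split_ifs with h
  · exact posRealIdele_snd K ρ
  · rfl

/-- The finite part of `a y⁻¹` is `(y_f)⁻¹` for `a ∈ A_G`. [folklore] -/
theorem sndHom_center_mul_inv (a : (AdelicGroupData.gl n K).center') (y : (AdelicGroupData.gl n K).Adelic) :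
    GLn.sndHom n K ((((a : (AdelicGroupData.gl n K).Adelic) * y⁻¹ : (AdelicGroupData.gl n K).Adelic)) :
        GL (Fin n) (AdeleRing (𝓞 K) K)) =
      (GLn.sndHom n K (y : GL (Fin n) (AdeleRing (𝓞 K) K)))⁻¹ := by
  set g : GL (Fin n) (AdeleRing (𝓞 K) K) := (a : (AdelicGroupData.gl n K).Adelic) with hg
  set h : GL (Fin n) (AdeleRing (𝓞 K) K) := y with hh
  change GLn.sndHom n K (g * h⁻¹) = (GLn.sndHom n K h)⁻¹
  rw [map_mul, map_inv, hg, sndHom_center_eq_one, one_mul]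

/-- **The truncation weight along the centre**: `|F₁(x a y)| = 𝟙_{v < -log R} R^σ e^{σ v}` with
`v = centerLog a`, `R = |det x| |det y|`, `σ = re s`. [folklore] -/
theorem enorm_gjTruncF_one_center (hn : 0 < n) (s : ℂ) (x y : (AdelicGroupData.gl n K).Adelic)
    (a : (AdelicGroupData.gl n K).center') :
    (‖gjTruncF n K (fun _ => (1 : ℂ)) s (x * (a : (AdelicGroupData.gl n K).Adelic) * y)‖ₑ : ℝ≥0∞) =
      (Iio (-Real.log ((adelicAbsDet n K x : ℝ) * (adelicAbsDet n K y : ℝ)))).indicator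
        (fun v => ENNReal.ofReal (((adelicAbsDet n K x : ℝ) * (adelicAbsDet n K y : ℝ)) ^ s.re *
          Real.exp (s.re * v))) (centerLog n K hn a) := by
  set R : ℝ := (adelicAbsDet n K x : ℝ) * (adelicAbsDet n K y : ℝ) with hR
  have hRpos : 0 < R := mul_pos (adelicAbsDet_pos _) (adelicAbsDet_pos _)
  rw [gjTruncF_one_mul_center_mul_eq hn s x y a]
  by_cases hv : centerLog n K hn a ∈ Iio (-Real.log R)
  · rw [indicator_of_mem hv, indicator_of_mem hv, ← ofReal_norm, Complex.norm_exp]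
    congr 1
    rw [Complex.mul_re, Complex.ofReal_re, Complex.ofReal_im, mul_zero, sub_zero, mul_add, Real.exp_add,
      Real.rpow_def_of_pos hRpos, mul_comm (Real.log R)]
  · rw [indicator_of_notMem hv, indicator_of_notMem hv, enorm_zero]

/-- `|det y⁻¹|_𝔸 = |det y|_𝔸⁻¹`. [folklore] -/
theorem coe_adelicAbsDet_inv (y : GL (Fin n) (AdeleRing (𝓞 K) K)) :
    ((adelicAbsDet n K y⁻¹ : ℝ≥0) : ℝ) = ((adelicAbsDet n K y : ℝ≥0) : ℝ)⁻¹ := by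
  rw [map_inv, NNReal.coe_inv]

/-- **`|det y|_𝔸^{-1} ≤ (n!)^{[K:ℚ]} (1 ⊔ ‖y‖)^{n[K:ℚ]}`** (from `ideleNorm_det_inv_le_height`). [folklore] -/
theorem adelicAbsDet_inv_le_height [NeZero n] (y : GL (Fin n) (AdeleRing (𝓞 K) K)) :
    ((adelicAbsDet n K y : ℝ≥0) : ℝ)⁻¹ ≤
      (n.factorial : ℝ) ^ Module.finrank ℚ K * (1 ⊔ adelicHeightGL n K y) ^ (n * Module.finrank ℚ K) := by
  rw [adelicAbsDet_apply, coe_ideleNorm]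
  exact ideleNorm_det_inv_le_height y

/-- **`|det y|_𝔸 ≤ (n!)^{[K:ℚ]} (1 ⊔ ‖y‖)^{n[K:ℚ]}`** (from `ideleNorm_det_le_height`). [folklore] -/
theorem adelicAbsDet_le_height [NeZero n] (y : GL (Fin n) (AdeleRing (𝓞 K) K)) :
    ((adelicAbsDet n K y : ℝ≥0) : ℝ) ≤
      (n.factorial : ℝ) ^ Module.finrank ℚ K * (1 ⊔ adelicHeightGL n K y) ^ (n * Module.finrank ℚ K) := by
  rw [adelicAbsDet_apply, coe_ideleNorm]
  exact ideleNorm_det_le_height y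

/-- **The powers `R^{±κ}` of `R = |det x₀| / |det y|` are polynomial in `‖y‖`**: for `κ ≥ 0`,
`R^{-κ} + R^{κ} ≤ (|det x₀|^{-κ} + |det x₀|^{κ}) (n!)^{[K:ℚ] κ} (1 ⊔ ‖y‖)^{n [K:ℚ] κ}`. [folklore] -/
theorem rpow_neg_add_rpow_detRatio_le [NeZero n] {κ : ℝ} (hκ : 0 ≤ κ) (x₀ y : GL (Fin n) (AdeleRing (𝓞 K) K)) :
    (((adelicAbsDet n K x₀ : ℝ≥0) : ℝ) * ((adelicAbsDet n K y⁻¹ : ℝ≥0) : ℝ)) ^ (-κ) +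
        (((adelicAbsDet n K x₀ : ℝ≥0) : ℝ) * ((adelicAbsDet n K y⁻¹ : ℝ≥0) : ℝ)) ^ κ ≤
      ((((adelicAbsDet n K x₀ : ℝ≥0) : ℝ)) ^ (-κ) + (((adelicAbsDet n K x₀ : ℝ≥0) : ℝ)) ^ κ) *
        (((n.factorial : ℝ) ^ Module.finrank ℚ K) ^ κ *
          (1 ⊔ adelicHeightGL n K y) ^ ((n * Module.finrank ℚ K : ℕ) * κ)) := by
  set Dx : ℝ := ((adelicAbsDet n K x₀ : ℝ≥0) : ℝ) with hDx
  set Dy : ℝ := ((adelicAbsDet n K y : ℝ≥0) : ℝ) with hDy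
  set F : ℝ := (n.factorial : ℝ) ^ Module.finrank ℚ K with hF
  set H : ℝ := 1 ⊔ adelicHeightGL n K y with hH
  have hDx0 : 0 < Dx := adelicAbsDet_pos _
  have hDy0 : 0 < Dy := adelicAbsDet_pos _
  have hF0 : 0 ≤ F := by positivity
  have hH1 : 1 ≤ H := le_sup_left
  have hH0 : 0 < H := one_pos.trans_le hH1
  have hbound : ∀ t : ℝ, 0 < t → t ≤ F * H ^ (n * Module.finrank ℚ K) →
      t ^ κ ≤ F ^ κ * H ^ ((n * Module.finrank ℚ K : ℕ) * κ) := by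
    intro t ht hle
    calc t ^ κ ≤ (F * H ^ (n * Module.finrank ℚ K)) ^ κ := Real.rpow_le_rpow ht.le hle hκ
      _ = F ^ κ * H ^ ((n * Module.finrank ℚ K : ℕ) * κ) := by
          rw [Real.mul_rpow hF0 (pow_nonneg hH0.le _), ← Real.rpow_natCast H, ← Real.rpow_mul hH0.le]
  rw [coe_adelicAbsDet_inv, ← hDy]
  have e1 : (Dx * Dy⁻¹) ^ (-κ) = Dx ^ (-κ) * Dy ^ κ := by
    rw [Real.mul_rpow hDx0.le (inv_pos.2 hDy0).le, Real.inv_rpow hDy0.le, ← Real.rpow_neg hDy0.le, neg_neg]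
  have e2 : (Dx * Dy⁻¹) ^ κ = Dx ^ κ * Dy⁻¹ ^ κ := Real.mul_rpow hDx0.le (inv_pos.2 hDy0).le
  rw [e1, e2, add_mul]
  refine add_le_add ?_ ?_
  · exact mul_le_mul_of_nonneg_left (hbound Dy hDy0 (adelicAbsDet_le_height y)) (Real.rpow_nonneg hDx0.le _)
  · exact mul_le_mul_of_nonneg_left (hbound Dy⁻¹ (inv_pos.2 hDy0) (adelicAbsDet_inv_le_height y))
      (Real.rpow_nonneg hDx0.le _)

end TruncSide

/-! ### The `Φ`-side: `∫_{A_G} |F₁(x₀ a y⁻¹)| Σ_ξ |Φ(x₀ ξ a y⁻¹)| dα` is polynomially bounded in `‖y‖` -/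

section TruncMain

variable {n : ℕ} {K : Type} [Field K] [NumberField K]

attribute [local instance] adelicBorel borelSpace_adelic locallyCompactSpace_adelic
  secondCountableTopology_gl_adelic

/-- **Majorant of the `Φ`-side singular term, integrated over the centre.** Let `n ≥ 1`,
`Φ ∈ 𝒮(M_n(𝔸_K))`, `x₀ ∈ GL_n(𝔸_K)`, `re s > n + 1`, `𝒴 ⊆ GL_n(𝔸_K^∞)` compact and `α` a Haar
measure on `A_G` (`centerLog_* α = c · dv`). There is `C < ∞` such that for every `y` with `y_f ∈ 𝒴`

  `∫_{A_G} |F₁(x₀ a y⁻¹)| · Σ_{ξ ∈ M_n(K)} |Φ(x₀ ξ a y⁻¹)| dα(a) ≤ C (1 ⊔ ‖y‖)^{2θ}`,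
  `θ = n² [K:ℚ] + 1`,

where `F₁ = |det|^s 𝟙_{|det| < 1}` (`gjTruncF n K 1 s`) and `‖y‖` is the adelic height: the theta
series is `≪ (1 ⊔ ‖y‖)^θ e^{θ|v|/(n[K:ℚ])}` along `a = a(v)` (`thetaBound_center_mul_inv`), the
weight is `𝟙_{v < -log R} R^σ e^{σ v}`, `R = |det x₀|/|det y|` (`enorm_gjTruncF_one_center`), the
`v`-integral is `≤ (R^{-κ} + R^κ)/(σ - κ)`, `κ = θ/(n[K:ℚ]) < σ`
(`lintegral_indicator_truncWeight_le`), and `R^{±κ} ≪ (1 ⊔ ‖y‖)^θ` (`rpow_neg_add_rpow_detRatio_le`).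
This is the absolute convergence, for each fixed `x₀`, of the singular part of the theta integral
of Godement–Jacquet (1972), §12 (the estimate behind Lemma 12.10 / Prop. 12.12), in the form used
against rapidly decreasing cusp forms. [cite: GodementJacquetLNM260, §12] -/
theorem exists_lintegral_center_truncTheta_le (hn : 0 < n)
    {Φ : Matrix (Fin n) (Fin n) (AdeleRing (𝓞 K) K) → ℂ} (hΦ : Φ ∈ schwartzBruhatAdelicMatrix n K)
    (x₀ : (AdelicGroupData.gl n K).Adelic) {s : ℂ} (hs : (n : ℝ) + 1 < s.re)
    {𝒴 : Set (GL (Fin n) (FiniteAdeleRing (𝓞 K) K))} (h𝒴 : IsCompact 𝒴)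
    {α : Measure (AdelicGroupData.gl n K).center'} {c : ℝ≥0}
    (hα : α.map (centerLog n K hn) = c • (volume : Measure ℝ)) :
    ∃ C : ℝ≥0∞, C ≠ ⊤ ∧ ∀ y : (AdelicGroupData.gl n K).Adelic,
      GLn.sndHom n K (y : GL (Fin n) (AdeleRing (𝓞 K) K)) ∈ 𝒴 →
        ∫⁻ a : (AdelicGroupData.gl n K).center',
            (‖gjTruncF n K (fun _ => (1 : ℂ)) s (x₀ * (a : (AdelicGroupData.gl n K).Adelic) * y⁻¹)‖ₑ : ℝ≥0∞) *
              ∑' ξ : Matrix (Fin n) (Fin n) K,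
                (‖Φ ((Units.val x₀ : Matrix (Fin n) (Fin n) (AdeleRing (𝓞 K) K)) * ratMatrix n K ξ *
                  Units.val (((a : (AdelicGroupData.gl n K).Adelic) * y⁻¹ : (AdelicGroupData.gl n K).Adelic)))‖ₑ : ℝ≥0∞) ∂α ≤
          C * ENNReal.ofReal ((1 ⊔ adelicHeightGL n K (y : GL (Fin n) (AdeleRing (𝓞 K) K))) ^
            (2 * (((n * n : ℕ) : ℝ) * Module.finrank ℚ K + 1))) := by
  haveI : NeZero n := ⟨hn.ne'⟩
  -- exponents
  set d : ℕ := Module.finrank ℚ K with hd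
  set θ : ℝ := ((n * n : ℕ) : ℝ) * d + 1 with hθdef
  set Ninf : ℝ := ((n * d : ℕ) : ℝ) with hNinf
  set σ : ℝ := s.re with hσ
  have hd1 : (1 : ℝ) ≤ d := by exact_mod_cast Module.finrank_pos (R := ℚ) (M := K)
  have hn1 : (1 : ℝ) ≤ n := by exact_mod_cast hn
  have hNinf_pos : 0 < Ninf := by rw [hNinf]; exact_mod_cast Nat.mul_pos hn Module.finrank_pos
  have hθ0 : 0 ≤ θ := by positivity
  have hθ : ((n * n : ℕ) : ℝ) * Module.finrank ℚ K < θ := lt_add_one _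
  set κ : ℝ := θ / Ninf with hκ
  have hκ0 : 0 ≤ κ := div_nonneg hθ0 hNinf_pos.le
  have hκσ : κ < σ := by
    -- `κ = n + 1/(n d) ≤ n + 1 < σ`
    have hκle : κ ≤ n + 1 := by
      rw [hκ, div_le_iff₀ hNinf_pos, hθdef, hNinf]
      push_cast
      nlinarith [mul_nonneg (sub_nonneg.2 hn1) (sub_nonneg.2 hd1), hn1, hd1]
    exact hκle.trans_lt hs
  have hNκ : ((n * d : ℕ) : ℝ) * κ = θ := by
    rw [hκ, ← hNinf, mul_div_cancel₀ _ hNinf_pos.ne']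
  -- the theta bound
  have hℬ : IsCompact ((fun g : GL (Fin n) (FiniteAdeleRing (𝓞 K) K) => g⁻¹) '' 𝒴) := h𝒴.image continuous_inv
  obtain ⟨B, hB, hmain⟩ := exists_tsum_enorm_mul_ratMatrix_mul_le hΦ
    (isCompact_singleton (x := GLn.sndHom n K (x₀ : GL (Fin n) (AdeleRing (𝓞 K) K)))) hℬ hθ
  -- constants
  set N2 : ℝ := ((n * n : ℕ) : ℝ) ^ 2 with hN2
  have hN20 : 0 ≤ N2 := by positivity
  set Hx : ℝ := (GLn.archHeight n K (x₀ : GL (Fin n) (AdeleRing (𝓞 K) K)) : ℝ) with hHx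
  set A₁ : ℝ := max 1 (N2 * n * Hx) with hA₁
  have hA₁1 : 1 ≤ A₁ := le_max_left _ _
  set Dx : ℝ := ((adelicAbsDet n K (x₀ : GL (Fin n) (AdeleRing (𝓞 K) K)) : ℝ≥0) : ℝ) with hDx
  have hDx0 : 0 < Dx := adelicAbsDet_pos _
  set F : ℝ := (n.factorial : ℝ) ^ d with hF
  set D₁ : ℝ := (Dx ^ (-κ) + Dx ^ κ) * F ^ κ / (σ - κ) with hD₁
  have hD₁0 : 0 ≤ D₁ := div_nonneg (mul_nonneg (add_nonneg (Real.rpow_nonneg hDx0.le _) (Real.rpow_nonneg hDx0.le _))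
    (Real.rpow_nonneg (by positivity) _)) (by linarith)
  refine ⟨(c : ℝ≥0∞) * (B * ENNReal.ofReal (A₁ ^ θ)) * ENNReal.ofReal D₁, ?_, fun y hy => ?_⟩
  · exact ENNReal.mul_ne_top (ENNReal.mul_ne_top ENNReal.coe_ne_top (ENNReal.mul_ne_top hB ENNReal.ofReal_ne_top))
      ENNReal.ofReal_ne_top
  -- notation for `y`
  set Hy : ℝ := adelicHeightGL n K (y : GL (Fin n) (AdeleRing (𝓞 K) K)) with hHy
  set My : ℝ := 1 ⊔ Hy with hMy
  have hMy1 : 1 ≤ My := le_sup_left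
  have hMy0 : 0 < My := one_pos.trans_le hMy1
  set R : ℝ := Dx * ((adelicAbsDet n K (y⁻¹ : (AdelicGroupData.gl n K).Adelic) : ℝ≥0) : ℝ) with hR
  have hR0 : 0 < R := mul_pos hDx0 (adelicAbsDet_pos _)
  set Cst : ℝ≥0∞ := B * ENNReal.ofReal ((A₁ * My) ^ θ) with hCst
  have hCst_ne : Cst ≠ ⊤ := ENNReal.mul_ne_top hB ENNReal.ofReal_ne_top
  -- the majorant in the coordinate `v`
  set M : ℝ → ℝ≥0∞ := fun v => Cst * (Iio (-Real.log R)).indicator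
    (fun v => ENNReal.ofReal (R ^ σ * Real.exp (σ * v) * (Real.exp (κ * v) + Real.exp (-(κ * v))))) v with hM
  -- pointwise bound
  have hpt : ∀ a : (AdelicGroupData.gl n K).center',
      (‖gjTruncF n K (fun _ => (1 : ℂ)) s (x₀ * (a : (AdelicGroupData.gl n K).Adelic) * y⁻¹)‖ₑ : ℝ≥0∞) *
        ∑' ξ : Matrix (Fin n) (Fin n) K,
          (‖Φ ((Units.val x₀ : Matrix (Fin n) (Fin n) (AdeleRing (𝓞 K) K)) * ratMatrix n K ξ *
            Units.val (((a : (AdelicGroupData.gl n K).Adelic) * y⁻¹ : (AdelicGroupData.gl n K).Adelic)))‖ₑ : ℝ≥0∞) ≤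
        M (centerLog n K hn a) := by
    intro a
    -- the theta factor
    have hfin : GLn.sndHom n K ((((a : (AdelicGroupData.gl n K).Adelic) * y⁻¹ : (AdelicGroupData.gl n K).Adelic)) :
        GL (Fin n) (AdeleRing (𝓞 K) K)) ∈ (fun g : GL (Fin n) (FiniteAdeleRing (𝓞 K) K) => g⁻¹) '' 𝒴 :=
      ⟨_, hy, (sndHom_center_mul_inv a y).symm⟩
    have hT := hmain (x₀ : GL (Fin n) (AdeleRing (𝓞 K) K))
      ((((a : (AdelicGroupData.gl n K).Adelic) * y⁻¹ : (AdelicGroupData.gl n K).Adelic)) : GL (Fin n) (AdeleRing (𝓞 K) K))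
      (mem_singleton _) hfin
    have hΘ := thetaBound_center_mul_inv (K := K) hθ0 hn hN20 x₀ y a hT
    -- the weight
    have hexp : Real.exp (θ * |centerLog n K hn a| / Ninf) = Real.exp (κ * |centerLog n K hn a|) := by
      rw [hκ, div_mul_eq_mul_div, mul_comm θ]
    rw [enorm_gjTruncF_one_center hn s x₀ (y⁻¹) a, hM]
    simp only
    by_cases hv : centerLog n K hn a ∈ Iio (-Real.log R)
    · rw [indicator_of_mem hv, indicator_of_mem hv]
      calc ENNReal.ofReal (R ^ σ * Real.exp (σ * centerLog n K hn a)) * _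
          ≤ ENNReal.ofReal (R ^ σ * Real.exp (σ * centerLog n K hn a)) *
              (Cst * ENNReal.ofReal (Real.exp (θ * |centerLog n K hn a| / Ninf))) :=
            mul_le_mul_right hΘ _
        _ = Cst * ENNReal.ofReal (R ^ σ * Real.exp (σ * centerLog n K hn a) *
              Real.exp (κ * |centerLog n K hn a|)) := by
            rw [mul_left_comm, ← ENNReal.ofReal_mul (mul_nonneg (Real.rpow_nonneg hR0.le _) (Real.exp_pos _).le),
              hexp]
        _ ≤ Cst * ENNReal.ofReal (R ^ σ * Real.exp (σ * centerLog n K hn a) *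
              (Real.exp (κ * centerLog n K hn a) + Real.exp (-(κ * centerLog n K hn a)))) := by
            gcongr
            exact exp_mul_abs_le_add κ _
    · rw [indicator_of_notMem hv, indicator_of_notMem hv, zero_mul, mul_zero]
  -- integrate
  calc ∫⁻ a, _ ∂α ≤ ∫⁻ a, M (centerLog n K hn a) ∂α := lintegral_mono hpt
    _ = ∫⁻ v, M v ∂(α.map (centerLog n K hn)) := by
        rw [← (centerLog n K hn).toMeasurableEquiv_coe, lintegral_map_equiv]
    _ = (c : ℝ≥0∞) * ∫⁻ v, M v := by rw [hα, lintegral_smul_measure]; rfl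
    _ = (c : ℝ≥0∞) * (Cst * ∫⁻ v, (Iio (-Real.log R)).indicator
          (fun v => ENNReal.ofReal (R ^ σ * Real.exp (σ * v) * (Real.exp (κ * v) + Real.exp (-(κ * v))))) v) := by
        rw [hM, lintegral_const_mul' _ _ hCst_ne]
    _ ≤ (c : ℝ≥0∞) * (Cst * ENNReal.ofReal ((R ^ (-κ) + R ^ κ) / (σ - κ))) := by
        gcongr
        exact lintegral_indicator_truncWeight_le hR0 hκ0 hκσ
    _ ≤ (c : ℝ≥0∞) * (Cst * ENNReal.ofReal (D₁ * My ^ θ)) := by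
        gcongr (c : ℝ≥0∞) * (Cst * ENNReal.ofReal ?_)
        have h := rpow_neg_add_rpow_detRatio_le (K := K) hκ0 (x₀ : GL (Fin n) (AdeleRing (𝓞 K) K))
          (y : GL (Fin n) (AdeleRing (𝓞 K) K))
        rw [hNκ] at h
        calc (R ^ (-κ) + R ^ κ) / (σ - κ) ≤ ((Dx ^ (-κ) + Dx ^ κ) * (F ^ κ * My ^ θ)) / (σ - κ) :=
              div_le_div_of_nonneg_right h (by linarith)
          _ = D₁ * My ^ θ := by rw [hD₁]; ring
    _ = (c : ℝ≥0∞) * (B * ENNReal.ofReal (A₁ ^ θ)) * ENNReal.ofReal D₁ * ENNReal.ofReal (My ^ (2 * θ)) := by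
        have hX2 : ENNReal.ofReal (My ^ (2 * θ)) = ENNReal.ofReal (My ^ θ) * ENNReal.ofReal (My ^ θ) := by
          rw [two_mul, Real.rpow_add hMy0, ENNReal.ofReal_mul (Real.rpow_nonneg hMy0.le _)]
        rw [hX2, hCst, Real.mul_rpow (zero_le_one.trans hA₁1) hMy0.le,
          ENNReal.ofReal_mul (Real.rpow_nonneg (zero_le_one.trans hA₁1) _), ENNReal.ofReal_mul hD₁0]
        ring

end TruncMain

/-! ### The `Φ̂`-side: `∫_{A_G} |F''(y a x₀⁻¹)| Σ_ξ |Ψ(y a ξ x₀⁻¹)| dα` is polynomially bounded in `‖y‖` -/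

section DualSide

variable {n : ℕ} {K : Type} [Field K] [NumberField K]

attribute [local instance] adelicBorel borelSpace_adelic locallyCompactSpace_adelic
  secondCountableTopology_gl_adelic

/-- The finite part of `y a` is `y_f` for `a ∈ A_G`. [folklore] -/
theorem sndHom_mul_center (y : (AdelicGroupData.gl n K).Adelic) (a : (AdelicGroupData.gl n K).center') :
    GLn.sndHom n K (((y * (a : (AdelicGroupData.gl n K).Adelic) : (AdelicGroupData.gl n K).Adelic)) :
        GL (Fin n) (AdeleRing (𝓞 K) K)) =
      GLn.sndHom n K (y : GL (Fin n) (AdeleRing (𝓞 K) K)) := by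
  set g : GL (Fin n) (AdeleRing (𝓞 K) K) := (a : (AdelicGroupData.gl n K).Adelic) with hg
  set h : GL (Fin n) (AdeleRing (𝓞 K) K) := y with hh
  change GLn.sndHom n K (h * g) = GLn.sndHom n K h
  rw [map_mul, hg, sndHom_center_eq_one, mul_one]

/-- **The archimedean height of `y a`**, `a ∈ A_G`: `H_∞(y a) ≤ n e^{|v|/(n[K:ℚ])} ‖y‖`. [folklore] -/
theorem archHeight_mul_center_le (hn : 0 < n) (y : (AdelicGroupData.gl n K).Adelic)
    (a : (AdelicGroupData.gl n K).center') :
    (GLn.archHeight n K (((y * (a : (AdelicGroupData.gl n K).Adelic) : (AdelicGroupData.gl n K).Adelic)) :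
        GL (Fin n) (AdeleRing (𝓞 K) K)) : ℝ) ≤
      n * Real.exp (|centerLog n K hn a| / ((n * Module.finrank ℚ K : ℕ) : ℝ)) *
        adelicHeightGL n K (y : GL (Fin n) (AdeleRing (𝓞 K) K)) := by
  haveI : NeZero n := ⟨hn.ne'⟩
  set g : GL (Fin n) (AdeleRing (𝓞 K) K) := (a : (AdelicGroupData.gl n K).Adelic) with hg
  set h : GL (Fin n) (AdeleRing (𝓞 K) K) := y with hh
  have hprod : (((y * (a : (AdelicGroupData.gl n K).Adelic) : (AdelicGroupData.gl n K).Adelic)) :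
      GL (Fin n) (AdeleRing (𝓞 K) K)) = h * g := rfl
  rw [hprod]
  calc (GLn.archHeight n K (h * g) : ℝ) ≤ adelicHeightGL n K (h * g) := archHeight_le_adelicHeightGL _
    _ ≤ n * adelicHeightGL n K h * adelicHeightGL n K g := adelicHeightGL_mul_le_const h g
    _ ≤ n * adelicHeightGL n K h * Real.exp (|centerLog n K hn a| / ((n * Module.finrank ℚ K : ℕ) : ℝ)) :=
        mul_le_mul_of_nonneg_left (adelicHeightGL_center_le hn a)
          (mul_nonneg (Nat.cast_nonneg _) (adelicHeightGL_nonneg h))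
    _ = _ := by ring

/-- **The theta factor along the centre (the `Φ̂`-side).** [folklore] -/
theorem thetaBound_mul_center {θ : ℝ} (hθ : 0 ≤ θ) (hn : 0 < n) {N2 : ℝ} (hN2 : 0 ≤ N2)
    {B₀ T : ℝ≥0∞} (x₀ y : (AdelicGroupData.gl n K).Adelic) (a : (AdelicGroupData.gl n K).center')
    (hT : T ≤ B₀ * ENNReal.ofReal ((max 1 (N2 *
      ((GLn.archHeight n K (((y * (a : (AdelicGroupData.gl n K).Adelic) : (AdelicGroupData.gl n K).Adelic)) :
          GL (Fin n) (AdeleRing (𝓞 K) K)) : ℝ) *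
        (GLn.archHeight n K ((x₀⁻¹ : (AdelicGroupData.gl n K).Adelic) : GL (Fin n) (AdeleRing (𝓞 K) K)) : ℝ)))) ^ θ)) :
    T ≤ B₀ * ENNReal.ofReal (((max 1 (N2 * n *
        (GLn.archHeight n K ((x₀⁻¹ : (AdelicGroupData.gl n K).Adelic) : GL (Fin n) (AdeleRing (𝓞 K) K)) : ℝ))) *
        (max 1 (adelicHeightGL n K (y : GL (Fin n) (AdeleRing (𝓞 K) K))))) ^ θ) *
      ENNReal.ofReal (Real.exp (θ * |centerLog n K hn a| / ((n * Module.finrank ℚ K : ℕ) : ℝ))) := by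
  set Ninf : ℝ := ((n * Module.finrank ℚ K : ℕ) : ℝ) with hNinf
  set E : ℝ := Real.exp (|centerLog n K hn a| / Ninf) with hE
  set Hx : ℝ := (GLn.archHeight n K ((x₀⁻¹ : (AdelicGroupData.gl n K).Adelic) : GL (Fin n) (AdeleRing (𝓞 K) K)) : ℝ)
    with hHx
  set Hy : ℝ := adelicHeightGL n K (y : GL (Fin n) (AdeleRing (𝓞 K) K)) with hHy
  have hE1 : 1 ≤ E := Real.one_le_exp (div_nonneg (abs_nonneg _) (by positivity))
  have hHx0 : 0 ≤ Hx := NNReal.coe_nonneg _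
  have hHy0 : 0 ≤ Hy := adelicHeightGL_nonneg _
  have hya : (GLn.archHeight n K (((y * (a : (AdelicGroupData.gl n K).Adelic) :
      (AdelicGroupData.gl n K).Adelic)) : GL (Fin n) (AdeleRing (𝓞 K) K)) : ℝ) ≤ n * E * Hy :=
    archHeight_mul_center_le hn y a
  have h1 : (1 : ℝ) ≤ (max 1 (N2 * n * Hx)) * (max 1 Hy) * E :=
    calc (1 : ℝ) = 1 * 1 * 1 := by ring
      _ ≤ (max 1 (N2 * n * Hx)) * (max 1 Hy) * E :=
          mul_le_mul (mul_le_mul (le_max_left _ _) (le_max_left _ _) zero_le_one (zero_le_one.trans (le_max_left _ _)))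
            hE1 zero_le_one (mul_nonneg (zero_le_one.trans (le_max_left _ _)) (zero_le_one.trans (le_max_left _ _)))
  have h2 : N2 * ((GLn.archHeight n K (((y * (a : (AdelicGroupData.gl n K).Adelic) :
      (AdelicGroupData.gl n K).Adelic)) : GL (Fin n) (AdeleRing (𝓞 K) K)) : ℝ) * Hx) ≤
      (max 1 (N2 * n * Hx)) * (max 1 Hy) * E :=
    calc N2 * ((GLn.archHeight n K (((y * (a : (AdelicGroupData.gl n K).Adelic) :
          (AdelicGroupData.gl n K).Adelic)) : GL (Fin n) (AdeleRing (𝓞 K) K)) : ℝ) * Hx)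
        ≤ N2 * ((n * E * Hy) * Hx) := mul_le_mul_of_nonneg_left (mul_le_mul_of_nonneg_right hya hHx0) hN2
      _ = (N2 * n * Hx) * Hy * E := by ring
      _ ≤ (max 1 (N2 * n * Hx)) * (max 1 Hy) * E :=
          mul_le_mul_of_nonneg_right (mul_le_mul (le_max_right _ _) (le_max_right _ _) hHy0
            (zero_le_one.trans (le_max_left _ _))) (zero_le_one.trans hE1)
  have hkey := max_le h1 h2
  have hreal : (max 1 (N2 * ((GLn.archHeight n K (((y * (a : (AdelicGroupData.gl n K).Adelic) :
        (AdelicGroupData.gl n K).Adelic)) : GL (Fin n) (AdeleRing (𝓞 K) K)) : ℝ) * Hx))) ^ θ ≤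
      ((max 1 (N2 * n * Hx)) * (max 1 Hy)) ^ θ * Real.exp (θ * |centerLog n K hn a| / Ninf) :=
    calc (max 1 (N2 * ((GLn.archHeight n K (((y * (a : (AdelicGroupData.gl n K).Adelic) :
          (AdelicGroupData.gl n K).Adelic)) : GL (Fin n) (AdeleRing (𝓞 K) K)) : ℝ) * Hx))) ^ θ
        ≤ ((max 1 (N2 * n * Hx)) * (max 1 Hy) * E) ^ θ :=
          Real.rpow_le_rpow (zero_le_one.trans (le_max_left _ _)) hkey hθ
      _ = ((max 1 (N2 * n * Hx)) * (max 1 Hy)) ^ θ * E ^ θ :=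
          Real.mul_rpow (mul_nonneg (zero_le_one.trans (le_max_left _ _)) (zero_le_one.trans (le_max_left _ _)))
            (zero_le_one.trans hE1)
      _ = ((max 1 (N2 * n * Hx)) * (max 1 Hy)) ^ θ * Real.exp (θ * |centerLog n K hn a| / Ninf) := by
          rw [hE, ← Real.exp_mul, div_mul_eq_mul_div, mul_comm _ θ]
  have hE' : ENNReal.ofReal ((max 1 (N2 * ((GLn.archHeight n K (((y * (a : (AdelicGroupData.gl n K).Adelic) :
        (AdelicGroupData.gl n K).Adelic)) : GL (Fin n) (AdeleRing (𝓞 K) K)) : ℝ) * Hx))) ^ θ) ≤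
      ENNReal.ofReal (((max 1 (N2 * n * Hx)) * (max 1 Hy)) ^ θ) *
        ENNReal.ofReal (Real.exp (θ * |centerLog n K hn a| / Ninf)) :=
    calc _ ≤ ENNReal.ofReal (((max 1 (N2 * n * Hx)) * (max 1 Hy)) ^ θ * Real.exp (θ * |centerLog n K hn a| / Ninf)) :=
          ENNReal.ofReal_le_ofReal hreal
      _ = _ := ENNReal.ofReal_mul (Real.rpow_nonneg (mul_nonneg (zero_le_one.trans (le_max_left _ _))
          (zero_le_one.trans (le_max_left _ _))) _)
  calc T ≤ _ := hT
    _ ≤ B₀ * (ENNReal.ofReal (((max 1 (N2 * n * Hx)) * (max 1 Hy)) ^ θ) *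
        ENNReal.ofReal (Real.exp (θ * |centerLog n K hn a| / Ninf))) := mul_le_mul_right hE' B₀
    _ = _ := (mul_assoc _ _ _).symm

/-- **The dual weight along the centre**: `|F''_w(y a x)| = 𝟙_{v > -log R} R^{re w} e^{re w · v}` with
`v = centerLog a`, `R = |det y| |det x|`. [folklore] -/
theorem enorm_gjDualF_one_center (hn : 0 < n) (w : ℂ) (y x : (AdelicGroupData.gl n K).Adelic)
    (a : (AdelicGroupData.gl n K).center') :
    (‖gjDualF n K (fun _ => (1 : ℂ)) w (y * (a : (AdelicGroupData.gl n K).Adelic) * x)‖ₑ : ℝ≥0∞) =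
      (Ioi (-Real.log ((adelicAbsDet n K y : ℝ) * (adelicAbsDet n K x : ℝ)))).indicator
        (fun v => ENNReal.ofReal (((adelicAbsDet n K y : ℝ) * (adelicAbsDet n K x : ℝ)) ^ w.re *
          Real.exp (w.re * v))) (centerLog n K hn a) := by
  set R : ℝ := (adelicAbsDet n K y : ℝ) * (adelicAbsDet n K x : ℝ) with hR
  have hRpos : 0 < R := mul_pos (adelicAbsDet_pos _) (adelicAbsDet_pos _)
  rw [gjDualF_one_mul_center_mul_eq hn w y x a]
  by_cases hv : centerLog n K hn a ∈ Ioi (-Real.log R)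
  · rw [indicator_of_mem hv, indicator_of_mem hv, ← ofReal_norm, Complex.norm_exp]
    congr 1
    rw [Complex.mul_re, Complex.ofReal_re, Complex.ofReal_im, mul_zero, sub_zero, mul_add, Real.exp_add,
      Real.rpow_def_of_pos hRpos, mul_comm (Real.log R)]
  · rw [indicator_of_notMem hv, indicator_of_notMem hv, enorm_zero]

/-- The powers `R^{±κ}` of `R = |det y| / |det x₀|` are polynomial in `‖y‖`. [folklore] -/
theorem rpow_neg_add_rpow_detRatio_le' [NeZero n] {κ : ℝ} (hκ : 0 ≤ κ) (x₀ y : GL (Fin n) (AdeleRing (𝓞 K) K)) :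
    (((adelicAbsDet n K y : ℝ≥0) : ℝ) * ((adelicAbsDet n K x₀⁻¹ : ℝ≥0) : ℝ)) ^ (-κ) +
        (((adelicAbsDet n K y : ℝ≥0) : ℝ) * ((adelicAbsDet n K x₀⁻¹ : ℝ≥0) : ℝ)) ^ κ ≤
      ((((adelicAbsDet n K x₀ : ℝ≥0) : ℝ)) ^ κ + (((adelicAbsDet n K x₀ : ℝ≥0) : ℝ)) ^ (-κ)) *
        (((n.factorial : ℝ) ^ Module.finrank ℚ K) ^ κ *
          (1 ⊔ adelicHeightGL n K y) ^ ((n * Module.finrank ℚ K : ℕ) * κ)) := by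
  set Dx : ℝ := ((adelicAbsDet n K x₀ : ℝ≥0) : ℝ) with hDx
  set Dy : ℝ := ((adelicAbsDet n K y : ℝ≥0) : ℝ) with hDy
  set F : ℝ := (n.factorial : ℝ) ^ Module.finrank ℚ K with hF
  set H : ℝ := 1 ⊔ adelicHeightGL n K y with hH
  have hDx0 : 0 < Dx := adelicAbsDet_pos _
  have hDy0 : 0 < Dy := adelicAbsDet_pos _
  have hF0 : 0 ≤ F := by positivity
  have hH1 : 1 ≤ H := le_sup_left
  have hH0 : 0 < H := one_pos.trans_le hH1
  have hbound : ∀ t : ℝ, 0 < t → t ≤ F * H ^ (n * Module.finrank ℚ K) →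
      t ^ κ ≤ F ^ κ * H ^ ((n * Module.finrank ℚ K : ℕ) * κ) := by
    intro t ht hle
    calc t ^ κ ≤ (F * H ^ (n * Module.finrank ℚ K)) ^ κ := Real.rpow_le_rpow ht.le hle hκ
      _ = F ^ κ * H ^ ((n * Module.finrank ℚ K : ℕ) * κ) := by
          rw [Real.mul_rpow hF0 (pow_nonneg hH0.le _), ← Real.rpow_natCast H, ← Real.rpow_mul hH0.le]
  rw [coe_adelicAbsDet_inv, ← hDx]
  have e1 : (Dy * Dx⁻¹) ^ (-κ) = Dy⁻¹ ^ κ * Dx ^ κ := by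
    rw [Real.mul_rpow hDy0.le (inv_pos.2 hDx0).le, Real.inv_rpow hDx0.le, ← Real.rpow_neg hDx0.le, neg_neg,
      Real.rpow_neg hDy0.le, Real.inv_rpow hDy0.le]
  have e2 : (Dy * Dx⁻¹) ^ κ = Dy ^ κ * Dx ^ (-κ) := by
    rw [Real.mul_rpow hDy0.le (inv_pos.2 hDx0).le, Real.inv_rpow hDx0.le, Real.rpow_neg hDx0.le]
  rw [e1, e2, add_mul]
  refine add_le_add ?_ ?_
  · rw [mul_comm]
    exact mul_le_mul_of_nonneg_left (hbound Dy⁻¹ (inv_pos.2 hDy0) (adelicAbsDet_inv_le_height y))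
      (Real.rpow_nonneg hDx0.le _)
  · rw [mul_comm]
    exact mul_le_mul_of_nonneg_left (hbound Dy hDy0 (adelicAbsDet_le_height y)) (Real.rpow_nonneg hDx0.le _)

/-- **Majorant of the `Φ̂`-side singular term, integrated over the centre.** Let `n ≥ 1`,
`Ψ ∈ 𝒮(M_n(𝔸_K))` (in the application `Ψ = Φ̂`), `x₀ ∈ GL_n(𝔸_K)`, `re s > 2n + 1`, `𝒴 ⊆ GL_n(𝔸_K^∞)`
compact and `α` a Haar measure on `A_G` (`centerLog_* α = c · dv`). There is `C < ∞` such that for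
every `y` with `y_f ∈ 𝒴`

  `∫_{A_G} |F''_{n-s}(y a x₀⁻¹)| · Σ_{ξ ∈ M_n(K)} |Ψ(y a ξ x₀⁻¹)| dα(a) ≤ C (1 ⊔ ‖y‖)^{2θ}`,
  `θ = n² [K:ℚ] + 1`,

`F''_w = |det|^w 𝟙_{|det| > 1}` (`gjDualF n K 1 w`): as on the `Φ`-side, with the weight
`𝟙_{v > -log R} R^{n-σ} e^{(n-σ) v}`, `R = |det y|/|det x₀|` and `τ = σ - n > κ`
(`lintegral_indicator_dualWeight_le`). (In the reflection formula the dual term appears at `a⁻¹`;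
the Haar measure of `A_G` is inversion invariant.) Godement–Jacquet (1972), §12.
[cite: GodementJacquetLNM260, §12] -/
theorem exists_lintegral_center_dualTheta_le (hn : 0 < n)
    {Ψ : Matrix (Fin n) (Fin n) (AdeleRing (𝓞 K) K) → ℂ} (hΨ : Ψ ∈ schwartzBruhatAdelicMatrix n K)
    (x₀ : (AdelicGroupData.gl n K).Adelic) {s : ℂ} (hs : 2 * (n : ℝ) + 1 < s.re)
    {𝒴 : Set (GL (Fin n) (FiniteAdeleRing (𝓞 K) K))} (h𝒴 : IsCompact 𝒴)
    {α : Measure (AdelicGroupData.gl n K).center'} {c : ℝ≥0}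
    (hα : α.map (centerLog n K hn) = c • (volume : Measure ℝ)) :
    ∃ C : ℝ≥0∞, C ≠ ⊤ ∧ ∀ y : (AdelicGroupData.gl n K).Adelic,
      GLn.sndHom n K (y : GL (Fin n) (AdeleRing (𝓞 K) K)) ∈ 𝒴 →
        ∫⁻ a : (AdelicGroupData.gl n K).center',
            (‖gjDualF n K (fun _ => (1 : ℂ)) ((n : ℂ) - s)
                (y * (a : (AdelicGroupData.gl n K).Adelic) * x₀⁻¹)‖ₑ : ℝ≥0∞) *
              ∑' ξ : Matrix (Fin n) (Fin n) K,
                (‖Ψ (Units.val ((y * (a : (AdelicGroupData.gl n K).Adelic) : (AdelicGroupData.gl n K).Adelic)) *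
                  ratMatrix n K ξ * (Units.val (x₀⁻¹ : (AdelicGroupData.gl n K).Adelic)))‖ₑ : ℝ≥0∞) ∂α ≤
          C * ENNReal.ofReal ((1 ⊔ adelicHeightGL n K (y : GL (Fin n) (AdeleRing (𝓞 K) K))) ^
            (2 * (((n * n : ℕ) : ℝ) * Module.finrank ℚ K + 1))) := by
  haveI : NeZero n := ⟨hn.ne'⟩
  -- exponents
  set d : ℕ := Module.finrank ℚ K with hd
  set θ : ℝ := ((n * n : ℕ) : ℝ) * d + 1 with hθdef
  set Ninf : ℝ := ((n * d : ℕ) : ℝ) with hNinf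
  set σ : ℝ := s.re with hσ
  set τ : ℝ := σ - n with hτ
  have hd1 : (1 : ℝ) ≤ d := by exact_mod_cast Module.finrank_pos (R := ℚ) (M := K)
  have hn1 : (1 : ℝ) ≤ n := by exact_mod_cast hn
  have hNinf_pos : 0 < Ninf := by rw [hNinf]; exact_mod_cast Nat.mul_pos hn Module.finrank_pos
  have hθ0 : 0 ≤ θ := by positivity
  have hθ : ((n * n : ℕ) : ℝ) * Module.finrank ℚ K < θ := lt_add_one _
  set κ : ℝ := θ / Ninf with hκ
  have hκ0 : 0 ≤ κ := div_nonneg hθ0 hNinf_pos.le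
  have hκτ : κ < τ := by
    have hκle : κ ≤ n + 1 := by
      rw [hκ, div_le_iff₀ hNinf_pos, hθdef, hNinf]
      push_cast
      nlinarith [mul_nonneg (sub_nonneg.2 hn1) (sub_nonneg.2 hd1), hn1, hd1]
    rw [hτ]
    linarith
  have hNκ : ((n * d : ℕ) : ℝ) * κ = θ := by
    rw [hκ, ← hNinf, mul_div_cancel₀ _ hNinf_pos.ne']
  have hwre : ((n : ℂ) - s).re = -τ := by
    rw [Complex.sub_re, Complex.natCast_re, hτ, hσ]; ring
  -- the theta bound
  obtain ⟨B, hB, hmain⟩ := exists_tsum_enorm_mul_ratMatrix_mul_le hΨ h𝒴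
    (isCompact_singleton (x := GLn.sndHom n K ((x₀⁻¹ : (AdelicGroupData.gl n K).Adelic) :
      GL (Fin n) (AdeleRing (𝓞 K) K)))) hθ
  -- constants
  set N2 : ℝ := ((n * n : ℕ) : ℝ) ^ 2 with hN2
  have hN20 : 0 ≤ N2 := by positivity
  set Hx : ℝ := (GLn.archHeight n K ((x₀⁻¹ : (AdelicGroupData.gl n K).Adelic) : GL (Fin n) (AdeleRing (𝓞 K) K)) : ℝ)
    with hHx
  set A₁ : ℝ := max 1 (N2 * n * Hx) with hA₁
  have hA₁1 : 1 ≤ A₁ := le_max_left _ _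
  set Dx : ℝ := ((adelicAbsDet n K (x₀ : GL (Fin n) (AdeleRing (𝓞 K) K)) : ℝ≥0) : ℝ) with hDx
  have hDx0 : 0 < Dx := adelicAbsDet_pos _
  set F : ℝ := (n.factorial : ℝ) ^ d with hF
  set D₁ : ℝ := (Dx ^ κ + Dx ^ (-κ)) * F ^ κ / (τ - κ) with hD₁
  have hD₁0 : 0 ≤ D₁ := div_nonneg (mul_nonneg (add_nonneg (Real.rpow_nonneg hDx0.le _) (Real.rpow_nonneg hDx0.le _))
    (Real.rpow_nonneg (by positivity) _)) (by linarith)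
  refine ⟨(c : ℝ≥0∞) * (B * ENNReal.ofReal (A₁ ^ θ)) * ENNReal.ofReal D₁, ?_, fun y hy => ?_⟩
  · exact ENNReal.mul_ne_top (ENNReal.mul_ne_top ENNReal.coe_ne_top (ENNReal.mul_ne_top hB ENNReal.ofReal_ne_top))
      ENNReal.ofReal_ne_top
  -- notation for `y`
  set Hy : ℝ := adelicHeightGL n K (y : GL (Fin n) (AdeleRing (𝓞 K) K)) with hHy
  set My : ℝ := 1 ⊔ Hy with hMy
  have hMy1 : 1 ≤ My := le_sup_left
  have hMy0 : 0 < My := one_pos.trans_le hMy1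
  set R : ℝ := ((adelicAbsDet n K (y : (AdelicGroupData.gl n K).Adelic) : ℝ≥0) : ℝ) *
    ((adelicAbsDet n K (x₀⁻¹ : (AdelicGroupData.gl n K).Adelic) : ℝ≥0) : ℝ) with hR
  have hR0 : 0 < R := mul_pos (adelicAbsDet_pos _) (adelicAbsDet_pos _)
  set Cst : ℝ≥0∞ := B * ENNReal.ofReal ((A₁ * My) ^ θ) with hCst
  have hCst_ne : Cst ≠ ⊤ := ENNReal.mul_ne_top hB ENNReal.ofReal_ne_top
  -- the majorant in the coordinate `v`
  set M : ℝ → ℝ≥0∞ := fun v => Cst * (Ioi (-Real.log R)).indicator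
    (fun v => ENNReal.ofReal (R ^ (-τ) * Real.exp (-(τ * v)) * (Real.exp (κ * v) + Real.exp (-(κ * v))))) v with hM
  -- pointwise bound
  have hpt : ∀ a : (AdelicGroupData.gl n K).center',
      (‖gjDualF n K (fun _ => (1 : ℂ)) ((n : ℂ) - s)
          (y * (a : (AdelicGroupData.gl n K).Adelic) * x₀⁻¹)‖ₑ : ℝ≥0∞) *
        ∑' ξ : Matrix (Fin n) (Fin n) K,
          (‖Ψ (Units.val ((y * (a : (AdelicGroupData.gl n K).Adelic) : (AdelicGroupData.gl n K).Adelic)) *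
            ratMatrix n K ξ * (Units.val (x₀⁻¹ : (AdelicGroupData.gl n K).Adelic)))‖ₑ : ℝ≥0∞) ≤
        M (centerLog n K hn a) := by
    intro a
    have hfin : GLn.sndHom n K (((y * (a : (AdelicGroupData.gl n K).Adelic) : (AdelicGroupData.gl n K).Adelic)) :
        GL (Fin n) (AdeleRing (𝓞 K) K)) ∈ 𝒴 := by
      rw [sndHom_mul_center]; exact hy
    have hT := hmain
      (((y * (a : (AdelicGroupData.gl n K).Adelic) : (AdelicGroupData.gl n K).Adelic)) : GL (Fin n) (AdeleRing (𝓞 K) K))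
      ((x₀⁻¹ : (AdelicGroupData.gl n K).Adelic) : GL (Fin n) (AdeleRing (𝓞 K) K)) hfin (mem_singleton _)
    have hΘ := thetaBound_mul_center (K := K) hθ0 hn hN20 x₀ y a hT
    have hexp : Real.exp (θ * |centerLog n K hn a| / Ninf) = Real.exp (κ * |centerLog n K hn a|) := by
      rw [hκ, div_mul_eq_mul_div, mul_comm θ]
    rw [enorm_gjDualF_one_center hn ((n : ℂ) - s) y (x₀⁻¹) a, hwre, hM]
    simp only
    by_cases hv : centerLog n K hn a ∈ Ioi (-Real.log R)
    · rw [indicator_of_mem hv, indicator_of_mem hv]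
      calc ENNReal.ofReal (R ^ (-τ) * Real.exp (-τ * centerLog n K hn a)) * _
          ≤ ENNReal.ofReal (R ^ (-τ) * Real.exp (-τ * centerLog n K hn a)) *
              (Cst * ENNReal.ofReal (Real.exp (θ * |centerLog n K hn a| / Ninf))) :=
            mul_le_mul_right hΘ _
        _ = Cst * ENNReal.ofReal (R ^ (-τ) * Real.exp (-(τ * centerLog n K hn a)) *
              Real.exp (κ * |centerLog n K hn a|)) := by
            rw [mul_left_comm, ← ENNReal.ofReal_mul (mul_nonneg (Real.rpow_nonneg hR0.le _) (Real.exp_pos _).le),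
              hexp, neg_mul]
        _ ≤ Cst * ENNReal.ofReal (R ^ (-τ) * Real.exp (-(τ * centerLog n K hn a)) *
              (Real.exp (κ * centerLog n K hn a) + Real.exp (-(κ * centerLog n K hn a)))) := by
            gcongr
            exact exp_mul_abs_le_add κ _
    · rw [indicator_of_notMem hv, indicator_of_notMem hv, zero_mul, mul_zero]
  -- integrate
  calc ∫⁻ a, _ ∂α ≤ ∫⁻ a, M (centerLog n K hn a) ∂α := lintegral_mono hpt
    _ = ∫⁻ v, M v ∂(α.map (centerLog n K hn)) := by
        rw [← (centerLog n K hn).toMeasurableEquiv_coe, lintegral_map_equiv]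
    _ = (c : ℝ≥0∞) * ∫⁻ v, M v := by rw [hα, lintegral_smul_measure]; rfl
    _ = (c : ℝ≥0∞) * (Cst * ∫⁻ v, (Ioi (-Real.log R)).indicator
          (fun v => ENNReal.ofReal (R ^ (-τ) * Real.exp (-(τ * v)) * (Real.exp (κ * v) + Real.exp (-(κ * v))))) v) := by
        rw [hM, lintegral_const_mul' _ _ hCst_ne]
    _ ≤ (c : ℝ≥0∞) * (Cst * ENNReal.ofReal ((R ^ (-κ) + R ^ κ) / (τ - κ))) := by
        gcongr
        exact lintegral_indicator_dualWeight_le hR0 hκ0 hκτ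
    _ ≤ (c : ℝ≥0∞) * (Cst * ENNReal.ofReal (D₁ * My ^ θ)) := by
        gcongr (c : ℝ≥0∞) * (Cst * ENNReal.ofReal ?_)
        have h := rpow_neg_add_rpow_detRatio_le' (K := K) hκ0 (x₀ : GL (Fin n) (AdeleRing (𝓞 K) K))
          (y : GL (Fin n) (AdeleRing (𝓞 K) K))
        rw [hNκ] at h
        calc (R ^ (-κ) + R ^ κ) / (τ - κ) ≤ ((Dx ^ κ + Dx ^ (-κ)) * (F ^ κ * My ^ θ)) / (τ - κ) :=
              div_le_div_of_nonneg_right h (by linarith)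
          _ = D₁ * My ^ θ := by rw [hD₁]; ring
    _ = (c : ℝ≥0∞) * (B * ENNReal.ofReal (A₁ ^ θ)) * ENNReal.ofReal D₁ * ENNReal.ofReal (My ^ (2 * θ)) := by
        have hX2 : ENNReal.ofReal (My ^ (2 * θ)) = ENNReal.ofReal (My ^ θ) * ENNReal.ofReal (My ^ θ) := by
          rw [two_mul, Real.rpow_add hMy0, ENNReal.ofReal_mul (Real.rpow_nonneg hMy0.le _)]
        rw [hX2, hCst, Real.mul_rpow (zero_le_one.trans hA₁1) hMy0.le,
          ENNReal.ofReal_mul (Real.rpow_nonneg (zero_le_one.trans hA₁1) _), ENNReal.ofReal_mul hD₁0]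
        ring

end DualSide

end Literature.NumberTheory.Automorphic
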